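import Mathlib
import Literature.Probability.Moments.HoeffdingCountingRange
import HarnessLib

/-!
# UniformSubsampleSampleSize — Theorem A160-A's sample size, proved (pub-qadeq, DEQ-A160; cell lead)

HONEST FRAMING: instance-level adjudication of specific advantage claims; no claim about BQP vs BPP
or the summit.

Companion of `UniformSubsampleMoments.lean` (deq-1's receipt for DEQ-A160: Yu, Rao, Wu, Liu, Liu, Wan,
*Quantum-assisted anomaly detection with multivariate Gaussian distribution*, arXiv:2505.02316v2 (2025)).
That file's header records that the deq-1 staging carried a statement-level
`def UniformSubsampleSampleSize : Prop` — Theorem A160-A's sample size `N ≥ (2/ε²)·ln((D²+3D)/δ)`,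
"Hoeffding 1963 + a union bound" — which was proved nowhere and therefore cut at filing (D-0026), "until it
is proved from Mathlib's Hoeffding inequality".  This file PROVES it, with the identical statement
(`uniformSubsample_sampleSize`), in a separate module only because of the 400-line cap on Theorems files.

* `muHat` / `sHat` — plug-in column means and raw second moments from an index tuple `ω : Fin N → Fin M`
  (rows drawn uniformly WITH replacement); `mu` / `sMom` — the exact ones.
* `card_muHat_far_le`, `card_sHat_far_le` — per statistic, at most `2e^{−Nε²/2}·M^N` of the `M^N` tuples
  are `ε`-far: Hoeffding's inequality in the RANGE form for `[−1, 1]`-valued statistics (Devroye–Györfi–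
  Lugosi 1996 Thm 8.1, tree `Literature.Probability.Moments.hoeffding_count_empiricalMean_abs`).
* `two_mul_card_le_pairs` — `2·#{(j,k) : j ≤ k} ≤ D² + D` (the second moments are symmetric in `j, k`,
  `sHat_comm` / `sMom_comm`, so `D + D(D+1)/2 ≤ (D²+3D)/2` events suffice).
* `uniformSubsample_sampleSize` — **Theorem A160-A (sample size)**: for `x ∈ [−1,1]^{M×D}`, `M ≥ 1`,
  `0 < ε`, `0 < δ < 1`, `N ≥ (2/ε²)·ln((D²+3D)/δ)`, at least `(1−δ)·M^N` index tuples give ALL plug-in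
  means and ALL plug-in raw second moments to additive accuracy `ε` simultaneously (union bound:
  `(D²+3D)·e^{−Nε²/2} ≤ δ`).  With `UniformSubsampleMoments.cov_eq_plugin` / `cov_plugin_error_le` this is
  the classical side of DEQ-A160's verdict: `O(D² log(D/δ)/ε²)` uniformly sampled rows, no `M`.

Everything is proved; no named facts; nothing here is a cited Literature fact.
-/

noncomputable section

namespace Summit.QuantumAdvantage.Dequantization.UniformSubsampleSampleSize

open Finset
open Literature.Probability.Moments

/-! ### Theorem A160-A: the sample size of uniform row subsampling (Hoeffding + union bound) -/

section sampleSize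

variable {M D N : ℕ}

/-- plug-in mean of column `j` from the index tuple `ω` (uniform draws with replacement) -/
def muHat (x : Fin M → Fin D → ℝ) (ω : Fin N → Fin M) (j : Fin D) : ℝ :=
  (∑ t, x (ω t) j) / N

/-- plug-in raw second moment of columns `j, k` from the index tuple `ω` -/
def sHat (x : Fin M → Fin D → ℝ) (ω : Fin N → Fin M) (j k : Fin D) : ℝ :=
  (∑ t, x (ω t) j * x (ω t) k) / N

/-- exact column mean `μ_j = (∑_i x_ij)/M` -/
def mu (x : Fin M → Fin D → ℝ) (j : Fin D) : ℝ := (∑ i, x i j) / M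

/-- exact raw second moment `S_jk = (∑_i x_ij x_ik)/M` -/
def sMom (x : Fin M → Fin D → ℝ) (j k : Fin D) : ℝ := (∑ i, x i j * x i k) / M

/-- `Ŝ_jk = Ŝ_kj`. -/
theorem sHat_comm (x : Fin M → Fin D → ℝ) (ω : Fin N → Fin M) (j k : Fin D) :
    sHat x ω j k = sHat x ω k j := by
  simp only [sHat, mul_comm]

/-- `S_jk = S_kj`. -/
theorem sMom_comm (x : Fin M → Fin D → ℝ) (j k : Fin D) : sMom x j k = sMom x k j := by
  simp only [sMom, mul_comm]

/-- `coordMean` over `Fin M` is the column mean. -/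
theorem coordMean_fin (g : Fin M → ℝ) : coordMean g = (∑ i, g i) / M := by
  simp [coordMean]

/-- One mean: the index tuples on which `|μ̂_j − μ_j| ≥ ε` number at most `2 e^{−Nε²/2} M^N`
(Hoeffding, range `[−1, 1]`). -/
theorem card_muHat_far_le (x : Fin M → Fin D → ℝ) (hM : 0 < M) (hx : ∀ i j, |x i j| ≤ 1)
    (hN : 0 < N) {ε : ℝ} (hε : 0 ≤ ε) (j : Fin D) :
    ((univ.filter fun ω : Fin N → Fin M => ε ≤ |muHat x ω j - mu x j|).card : ℝ) ≤
      2 * Real.exp (-(N * ε ^ 2 / 2)) * (M : ℝ) ^ N := by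
  haveI : Nonempty (Fin M) := ⟨⟨0, hM⟩⟩
  have h := hoeffding_count_empiricalMean_abs (κ := Fin M) (fun i => x i j) (a := -1) (b := 1)
    (by norm_num) (fun i => abs_le.1 (hx i j)) hN hε
  simp only [coordMean_fin, Fintype.card_fin] at h
  have hexp : -(2 * (N : ℝ) * ε ^ 2 / (1 - -1) ^ 2) = -(N * ε ^ 2 / 2) := by ring
  rw [hexp] at h
  exact h

/-- One second moment: the index tuples on which `|Ŝ_jk − S_jk| ≥ ε` number at most
`2 e^{−Nε²/2} M^N`. -/
theorem card_sHat_far_le (x : Fin M → Fin D → ℝ) (hM : 0 < M) (hx : ∀ i j, |x i j| ≤ 1)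
    (hN : 0 < N) {ε : ℝ} (hε : 0 ≤ ε) (j k : Fin D) :
    ((univ.filter fun ω : Fin N → Fin M => ε ≤ |sHat x ω j k - sMom x j k|).card : ℝ) ≤
      2 * Real.exp (-(N * ε ^ 2 / 2)) * (M : ℝ) ^ N := by
  haveI : Nonempty (Fin M) := ⟨⟨0, hM⟩⟩
  have hprod : ∀ i, x i j * x i k ∈ Set.Icc (-1 : ℝ) 1 := by
    intro i
    have ha := abs_le.1 (hx i j); have hb := abs_le.1 (hx i k)
    have : |x i j * x i k| ≤ 1 := by
      rw [abs_mul]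
      calc |x i j| * |x i k| ≤ 1 * 1 :=
            mul_le_mul (hx i j) (hx i k) (abs_nonneg _) zero_le_one
        _ = 1 := one_mul 1
    exact abs_le.1 this
  have h := hoeffding_count_empiricalMean_abs (κ := Fin M) (fun i => x i j * x i k) (a := -1)
    (b := 1) (by norm_num) hprod hN hε
  simp only [coordMean_fin, Fintype.card_fin] at h
  have hexp : -(2 * (N : ℝ) * ε ^ 2 / (1 - -1) ^ 2) = -(N * ε ^ 2 / 2) := by ring
  rw [hexp] at h
  exact h

/-- Counting the unordered pairs: `2 · #{(j,k) : j ≤ k} ≤ D² + D`. -/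
theorem two_mul_card_le_pairs (D : ℕ) :
    2 * ((univ : Finset (Fin D × Fin D)).filter fun p => p.1 ≤ p.2).card ≤ D ^ 2 + D := by
  set A := (univ : Finset (Fin D × Fin D)).filter fun p => p.1 ≤ p.2 with hA
  set B := (univ : Finset (Fin D × Fin D)).filter fun p => p.2 < p.1 with hB
  set Dg := (univ : Finset (Fin D × Fin D)).filter fun p => p.1 = p.2 with hDg
  -- `A` and `B` partition the square
  have hAB : A.card + B.card = D ^ 2 := by
    rw [hA, hB, ← card_union_of_disjoint, filter_union_right]
    · have : ((univ : Finset (Fin D × Fin D)).filter fun p => p.1 ≤ p.2 ∨ p.2 < p.1) = univ :=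
        eq_univ_iff_forall.2 fun p => by
          simp only [mem_filter, mem_univ, true_and]; exact le_or_gt _ _
      rw [this, card_univ, Fintype.card_prod, Fintype.card_fin, sq]
    · rw [disjoint_filter]; intro p _ h; exact not_lt.2 h
  -- swapping maps `A` onto `B ∪ diagonal`
  have hswap : A.card = (B ∪ Dg).card := by
    refine card_bij (fun p _ => (p.2, p.1)) ?_ ?_ ?_
    · intro p hp
      rw [hA, mem_filter] at hp
      rw [mem_union, hB, hDg, mem_filter, mem_filter]
      rcases hp.2.lt_or_eq with h | h
      · exact Or.inl ⟨mem_univ _, h⟩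
      · exact Or.inr ⟨mem_univ _, h.symm⟩
    · intro p _ q _ h
      simp only [Prod.mk.injEq] at h
      exact Prod.ext h.2 h.1
    · intro q hq
      refine ⟨(q.2, q.1), ?_, rfl⟩
      rw [mem_union, hB, hDg, mem_filter, mem_filter] at hq
      rw [hA, mem_filter]
      rcases hq with ⟨_, h⟩ | ⟨_, h⟩
      · exact ⟨mem_univ _, h.le⟩
      · exact ⟨mem_univ _, h.symm.le⟩
  have hBD : (B ∪ Dg).card ≤ B.card + Dg.card := card_union_le _ _
  have hDcard : Dg.card = D := by
    rw [hDg]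
    have : ((univ : Finset (Fin D × Fin D)).filter fun p => p.1 = p.2) =
        (univ : Finset (Fin D)).map ⟨fun j => (j, j), fun a b h => (Prod.mk.inj h).1⟩ := by
      ext p
      simp only [mem_filter, mem_univ, true_and, mem_map, Function.Embedding.coeFn_mk]
      constructor
      · intro h; exact ⟨p.1, Prod.ext rfl h⟩
      · rintro ⟨j, rfl⟩; rfl
    rw [this, card_map, card_univ, Fintype.card_fin]
  omega

/-- **Theorem A160-A, sample size** (the statement DEQ-A160 §4 cites from Hoeffding 1963 via
Devroye–Györfi–Lugosi 1996 Thm 8.1 + a union bound; it is the former staging-only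
`UniformSubsampleSampleSize`, now PROVED): for data `x ∈ [−1,1]^{M×D}`, `M ≥ 1`, `0 < ε`, `0 < δ < 1`
and `N ≥ (2/ε²)·ln((D²+3D)/δ)`, at least a `(1−δ)`-fraction of the `M^N` index tuples
`ω : Fin N → Fin M` (i.e. `N` rows drawn uniformly with replacement) give ALL `D` plug-in means and
ALL `D²` plug-in raw second moments to additive accuracy `ε` simultaneously. -/
theorem uniformSubsample_sampleSize (M D N : ℕ) (x : Fin M → Fin D → ℝ) (hM : 0 < M)
    (hx : ∀ i j, |x i j| ≤ 1) (ε δ : ℝ) (hε : 0 < ε) (hδ : 0 < δ) (hδ1 : δ < 1)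
    (hN : (2 / ε ^ 2) * Real.log (((D : ℝ) ^ 2 + 3 * D) / δ) ≤ N) :
    (1 - δ) * (M : ℝ) ^ N ≤
      ((univ.filter fun ω : Fin N → Fin M =>
          (∀ j, |muHat x ω j - mu x j| ≤ ε) ∧ ∀ j k, |sHat x ω j k - sMom x j k| ≤ ε).card : ℝ) := by
  classical
  have hMN : ((univ : Finset (Fin N → Fin M)).card : ℝ) = (M : ℝ) ^ N := by
    rw [card_univ, Fintype.card_fun, Fintype.card_fin, Fintype.card_fin]; push_cast; ring
  -- the degenerate case `D = 0`: every tuple is good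
  rcases Nat.eq_zero_or_pos D with rfl | hD
  · have hall : (univ.filter fun ω : Fin N → Fin M =>
        (∀ j : Fin 0, |muHat x ω j - mu x j| ≤ ε) ∧
          ∀ j k : Fin 0, |sHat x ω j k - sMom x j k| ≤ ε) = univ := by
      ext ω; simp
    rw [hall, hMN]
    have : 0 ≤ (M : ℝ) ^ N := by positivity
    nlinarith
  -- `D ≥ 1`: the sample size forces `N ≥ 1`
  have hDr : (1 : ℝ) ≤ D := by exact_mod_cast hD
  have hK : (4 : ℝ) ≤ (D : ℝ) ^ 2 + 3 * D := by nlinarith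
  have hKpos : (0 : ℝ) < (D : ℝ) ^ 2 + 3 * D := by linarith
  have hlog : 0 < Real.log (((D : ℝ) ^ 2 + 3 * D) / δ) := by
    apply Real.log_pos
    rw [lt_div_iff₀ hδ]; linarith
  have hNr : (0 : ℝ) < N := lt_of_lt_of_le (by positivity) hN
  have hNpos : 0 < N := by exact_mod_cast hNr
  -- the exponential factor
  set q : ℝ := Real.exp (-(N * ε ^ 2 / 2)) with hq
  have hq_le : ((D : ℝ) ^ 2 + 3 * D) * q ≤ δ := by
    have h1 : Real.log (((D : ℝ) ^ 2 + 3 * D) / δ) ≤ N * ε ^ 2 / 2 := by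
      have := hN
      rw [div_mul_eq_mul_div, div_le_iff₀ (by positivity)] at this
      linarith
    have h2 : q ≤ δ / ((D : ℝ) ^ 2 + 3 * D) := by
      rw [hq]
      calc Real.exp (-(N * ε ^ 2 / 2)) ≤ Real.exp (-Real.log (((D : ℝ) ^ 2 + 3 * D) / δ)) :=
            Real.exp_le_exp.2 (by linarith)
        _ = δ / ((D : ℝ) ^ 2 + 3 * D) := by
            rw [Real.exp_neg, Real.exp_log (by positivity), inv_div]
    calc ((D : ℝ) ^ 2 + 3 * D) * q ≤ ((D : ℝ) ^ 2 + 3 * D) * (δ / ((D : ℝ) ^ 2 + 3 * D)) :=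
          mul_le_mul_of_nonneg_left h2 hKpos.le
      _ = δ := mul_div_cancel₀ _ hKpos.ne'
  -- the bad events
  let Bμ : Fin D → Finset (Fin N → Fin M) := fun j =>
    univ.filter fun ω => ε ≤ |muHat x ω j - mu x j|
  let BS : Fin D × Fin D → Finset (Fin N → Fin M) := fun p =>
    univ.filter fun ω => ε ≤ |sHat x ω p.1 p.2 - sMom x p.1 p.2|
  let P : Finset (Fin D × Fin D) := univ.filter fun p => p.1 ≤ p.2
  let G : Finset (Fin N → Fin M) := univ.filter fun ω =>
    (∀ j, |muHat x ω j - mu x j| ≤ ε) ∧ ∀ j k, |sHat x ω j k - sMom x j k| ≤ ε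
  -- complement of the good set is covered by the bad events
  have hcover : univ \ G ⊆ univ.biUnion Bμ ∪ P.biUnion BS := by
    intro ω hω
    rw [mem_sdiff, mem_filter] at hω
    have hbad : ¬ ((∀ j, |muHat x ω j - mu x j| ≤ ε) ∧ ∀ j k, |sHat x ω j k - sMom x j k| ≤ ε) :=
      fun h => hω.2 ⟨mem_univ _, h⟩
    rw [mem_union, mem_biUnion, mem_biUnion]
    by_cases hμ : ∀ j, |muHat x ω j - mu x j| ≤ ε
    · have hS : ¬ ∀ j k, |sHat x ω j k - sMom x j k| ≤ ε := fun h => hbad ⟨hμ, h⟩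
      push Not at hS
      obtain ⟨j, k, hjk⟩ := hS
      right
      rcases le_total j k with h | h
      · exact ⟨(j, k), by simp [P, h], by simp [BS, hjk.le]⟩
      · refine ⟨(k, j), by simp [P, h], ?_⟩
        simp only [BS, mem_filter, mem_univ, true_and]
        rw [sHat_comm, sMom_comm]; exact hjk.le
    · push Not at hμ
      obtain ⟨j, hj⟩ := hμ
      left
      exact ⟨j, mem_univ _, by simp [Bμ, hj.le]⟩
  -- count
  have hcardG : ((univ \ G).card : ℝ) = (M : ℝ) ^ N - G.card := by
    rw [card_univ_sdiff, Nat.cast_sub (card_le_univ _), ← hMN, card_univ]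
  have hbad_le : ((univ \ G).card : ℝ) ≤ ((D : ℝ) ^ 2 + 3 * D) * q * (M : ℝ) ^ N := by
    calc ((univ \ G).card : ℝ)
        ≤ ((univ.biUnion Bμ ∪ P.biUnion BS).card : ℝ) := by exact_mod_cast card_le_card hcover
      _ ≤ ((univ.biUnion Bμ).card : ℝ) + ((P.biUnion BS).card : ℝ) := by
          exact_mod_cast card_union_le _ _
      _ ≤ (∑ j, (Bμ j).card : ℝ) + (∑ p ∈ P, (BS p).card : ℝ) := by
          gcongr <;> exact_mod_cast card_biUnion_le
      _ ≤ (∑ _j : Fin D, 2 * q * (M : ℝ) ^ N) + ∑ _p ∈ P, 2 * q * (M : ℝ) ^ N := by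
          gcongr with j _ p _
          · exact card_muHat_far_le x hM hx hNpos hε.le j
          · exact card_sHat_far_le x hM hx hNpos hε.le p.1 p.2
      _ = ((D : ℝ) + P.card) * (2 * q * (M : ℝ) ^ N) := by
          rw [sum_const, sum_const, card_univ, Fintype.card_fin, nsmul_eq_mul, nsmul_eq_mul]; ring
      _ ≤ ((D : ℝ) ^ 2 + 3 * D) * q * (M : ℝ) ^ N := by
          have hP : 2 * (P.card : ℝ) ≤ (D : ℝ) ^ 2 + D := by
            exact_mod_cast two_mul_card_le_pairs D
          have hq0 : 0 ≤ q := (Real.exp_pos _).le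
          have hMN0 : 0 ≤ (M : ℝ) ^ N := by positivity
          nlinarith [mul_nonneg hq0 hMN0]
  have hfinal : ((D : ℝ) ^ 2 + 3 * D) * q * (M : ℝ) ^ N ≤ δ * (M : ℝ) ^ N :=
    mul_le_mul_of_nonneg_right hq_le (by positivity)
  have : (M : ℝ) ^ N - G.card ≤ δ * (M : ℝ) ^ N := by rw [← hcardG]; exact hbad_le.trans hfinal
  linarith

end sampleSize

end Summit.QuantumAdvantage.Dequantization.UniformSubsampleSampleSize

end
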